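import Literature.Computability.AlgebraicComplexity.HrubesSensitiveMonotoneProofs
import Literature.Computability.AlgebraicComplexity.ConstantFreeCircuits
import HarnessLib

/-!
# Growing a list of fan-in-two gates WITH SIGN CONSTANTS (plumbing for constant-free passes)

Bookkeeping for gate-by-gate circuit transformations in the tree's model `ArithCircuit k σ`
(Bürgisser 2000, Def. 2.1) when the output must be CONSTANT-FREE in the sense of
`ArithCircuit.HasSignConstants` (every constant operand and every sum coefficient in
`{0, 1, -1}`; Bürgisser 2000 §1.4, Malod 2003, Bürgisser 2009 §2.2 — the model of the measure
`constantFreeComplexity = τ`).  It is the twin of the "growing plain gate list" plumbing of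
`HrubesSensitiveMonotoneProofs.lean` (namespace `Hrubes2020`: `avail_X`, `avail_C`, `extend_add`,
`extend_mul`, `iterate_extend`, `avail_sum_range`), with the invariant "fan-in two and plain"
replaced by "fan-in two with sign constants" and with availability of a polynomial `p` in a gate
list `gs` witnessed by a SIGN-CONSTANT operand:
`∃ u, u.RefsBelow gs.length ∧ u.HasSignConstants ∧ u.eval (gateValues gs) = p`.

* `CFGates.avail_mono`, `avail_X`, `avail_C` (for `c ∈ {0, 1, -1}`);
* `CFGates.extend_wsum` — ONE weighted-sum gate `a • u + b • w` with sign coefficients `a, b`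
  makes `a • p + b • q` available (so a pass may keep the coefficients of the old gate);
* `CFGates.extend_mul` — one product gate makes `p * q` available;
* `CFGates.iterate_extend`, `CFGates.avail_sum_range` — sequential iteration and accumulation
  of a sum `Σ_{l<m} t l` with coefficient-`1` additions, `(cost + 1) · m` gates.

All proved; no definitions, no named facts.  First consumer: the constant-free homogenisation
pass `HomogeneousComponentsConstantFree.lean` (`τ(f^{(d)}) ≤ (d + 2)² · τ(f)`, BCS 1997 Lemma
(21.25) in the constant-free model).  Honest framing: plumbing; nothing here bears on `VP ≠ VNP`.

## References

* [Burgisser2000] P. Bürgisser, *Completeness and Reduction in Algebraic Complexity Theory*,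
  Springer 2000, Def. 2.1 (the circuit model), §1.4 (constant-free computations).
* [Burgisser2009] P. Bürgisser, *On defining integers and proving arithmetic circuit lower
  bounds*, Comput. Complexity 18 (2009), §2.2 (`τ`).
-/

noncomputable section

namespace Literature.Computability.AlgebraicComplexity

open MvPolynomial

universe u v

namespace ArithCircuit

namespace CFGates

variable {k : Type u} [CommSemiring k] {σ : Type v}

/-- Availability (with a sign-constant witness) persists when the gate list grows at the end.
[cite: Burgisser2000, Def. 2.1] -/
theorem avail_mono {gs gs' : List (Gate k σ)} (h : gs <+: gs') {p : MvPolynomial σ k}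
    (hp : ∃ u : Operand k σ, u.RefsBelow gs.length ∧ u.HasSignConstants ∧
      u.eval (gateValues gs) = p) :
    ∃ u : Operand k σ, u.RefsBelow gs'.length ∧ u.HasSignConstants ∧
      u.eval (gateValues gs') = p := by
  obtain ⟨u, hu, hs, rfl⟩ := hp
  exact ⟨u, Hrubes2020.refsBelow_mono h.length_le hu, hs, Hrubes2020.operand_eval_of_prefix h hu⟩

/-- Variables are available for free. [cite: Burgisser2000, Def. 2.1] -/
theorem avail_X (gs : List (Gate k σ)) (i : σ) :
    ∃ u : Operand k σ, u.RefsBelow gs.length ∧ u.HasSignConstants ∧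
      u.eval (gateValues gs) = X i :=
  ⟨.var i, trivial, Operand.hasSignConstants_var i, rfl⟩

/-- Sign constants (`0, 1, -1`) are available for free. [cite: Burgisser2000, §1.4] -/
theorem avail_C (gs : List (Gate k σ)) {c : k} (hc : IsSignConstant c) :
    ∃ u : Operand k σ, u.RefsBelow gs.length ∧ u.HasSignConstants ∧
      u.eval (gateValues gs) = C c :=
  ⟨.const c, trivial, (Operand.hasSignConstants_const_iff c).2 hc, rfl⟩

/-- Appending ONE gate of fan-in `≤ 2` with sign constants whose operands read the current list
makes its value available, and keeps the invariant. [cite: Burgisser2000, Def. 2.1] -/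
theorem extend_gate {gs : List (Gate k σ)} (hgs : ∀ g ∈ gs, g.fanIn ≤ 2 ∧ g.HasSignConstants)
    (g : Gate k σ) (hg : g.fanIn ≤ 2) (hsg : g.HasSignConstants) :
    ∃ gs' : List (Gate k σ), gs <+: gs' ∧ (∀ g ∈ gs', g.fanIn ≤ 2 ∧ g.HasSignConstants) ∧
      gs'.length ≤ gs.length + 1 ∧
      ∃ u : Operand k σ, u.RefsBelow gs'.length ∧ u.HasSignConstants ∧
        u.eval (gateValues gs') = g.eval (gateValues gs) := by
  refine ⟨gs ++ [g], List.prefix_append _ _, ?_, by simp, .gate gs.length, ?_,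
    Operand.hasSignConstants_gate _, ?_⟩
  · intro g' hg'
    rw [List.mem_append, List.mem_singleton] at hg'
    rcases hg' with hg' | rfl
    · exact hgs g' hg'
    · exact ⟨hg, hsg⟩
  · simp [Operand.RefsBelow]
  · rw [gateValues_append_singleton]
    have hl := gateValues_length (k := k) gs
    simp [Operand.eval, List.getD_eq_getElem?_getD, hl]

/-- One weighted-sum gate `a • u + b • w` with SIGN coefficients `a, b`, appended at the end,
makes `a • p + b • q` available. [cite: Burgisser2000, Def. 2.1] -/
theorem extend_wsum {gs : List (Gate k σ)} {p q : MvPolynomial σ k} {a b : k}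
    (hgs : ∀ g ∈ gs, g.fanIn ≤ 2 ∧ g.HasSignConstants)
    (ha : IsSignConstant a) (hb : IsSignConstant b)
    (hp : ∃ u : Operand k σ, u.RefsBelow gs.length ∧ u.HasSignConstants ∧
      u.eval (gateValues gs) = p)
    (hq : ∃ u : Operand k σ, u.RefsBelow gs.length ∧ u.HasSignConstants ∧
      u.eval (gateValues gs) = q) :
    ∃ gs' : List (Gate k σ), gs <+: gs' ∧ (∀ g ∈ gs', g.fanIn ≤ 2 ∧ g.HasSignConstants) ∧
      gs'.length ≤ gs.length + 1 ∧
      ∃ u : Operand k σ, u.RefsBelow gs'.length ∧ u.HasSignConstants ∧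
        u.eval (gateValues gs') = a • p + b • q := by
  obtain ⟨up, hup, hsp, rfl⟩ := hp
  obtain ⟨uq, huq, hsq, rfl⟩ := hq
  have hsg : (Gate.sum [(a, up), (b, uq)]).HasSignConstants := by
    intro x hx
    simp only [List.mem_cons, List.not_mem_nil, or_false] at hx
    rcases hx with rfl | rfl
    · exact ⟨ha, hsp⟩
    · exact ⟨hb, hsq⟩
  obtain ⟨gs', hp', hg', hl', u, hu, hus, hue⟩ :=
    extend_gate hgs (Gate.sum [(a, up), (b, uq)]) (by simp [Gate.fanIn, Gate.args]) hsg
  refine ⟨gs', hp', hg', hl', u, hu, hus, ?_⟩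
  rw [hue]
  simp [Gate.eval]

/-- One product gate appended at the end makes `p * q` available. [cite: Burgisser2000, Def. 2.1] -/
theorem extend_mul {gs : List (Gate k σ)} {p q : MvPolynomial σ k}
    (hgs : ∀ g ∈ gs, g.fanIn ≤ 2 ∧ g.HasSignConstants)
    (hp : ∃ u : Operand k σ, u.RefsBelow gs.length ∧ u.HasSignConstants ∧
      u.eval (gateValues gs) = p)
    (hq : ∃ u : Operand k σ, u.RefsBelow gs.length ∧ u.HasSignConstants ∧
      u.eval (gateValues gs) = q) :
    ∃ gs' : List (Gate k σ), gs <+: gs' ∧ (∀ g ∈ gs', g.fanIn ≤ 2 ∧ g.HasSignConstants) ∧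
      gs'.length ≤ gs.length + 1 ∧
      ∃ u : Operand k σ, u.RefsBelow gs'.length ∧ u.HasSignConstants ∧
        u.eval (gateValues gs') = p * q := by
  obtain ⟨up, hup, hsp, rfl⟩ := hp
  obtain ⟨uq, huq, hsq, rfl⟩ := hq
  have hsg : (Gate.prod [up, uq]).HasSignConstants := by
    intro x hx
    simp only [List.mem_cons, List.not_mem_nil, or_false] at hx
    rcases hx with rfl | rfl
    · exact hsp
    · exact hsq
  obtain ⟨gs', hp', hg', hl', u, hu, hus, hue⟩ :=
    extend_gate hgs (Gate.prod [up, uq]) (by simp [Gate.fanIn, Gate.args]) hsg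
  refine ⟨gs', hp', hg', hl', u, hu, hus, ?_⟩
  rw [hue]
  simp [Gate.eval]

/-- Sequential iteration of extension steps (twin of `Hrubes2020.iterate_extend` for the
invariant "fan-in two with sign constants"): if, for every `l < m`, any good extension in which
the earlier targets hold can be extended by at most `cost` gates to one in which `Q l` holds,
and the `Q l` are monotone under extension, then `cost * m` gates make all `Q l`, `l < m`, hold.
[cite: Burgisser2000, Def. 2.1] -/
theorem iterate_extend (Q : ℕ → List (Gate k σ) → Prop)
    (hQ : ∀ l (gs₁ gs₂ : List (Gate k σ)), gs₁ <+: gs₂ → Q l gs₁ → Q l gs₂) (cost : ℕ)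
    (gs : List (Gate k σ)) (hgs : ∀ g ∈ gs, g.fanIn ≤ 2 ∧ g.HasSignConstants) :
    ∀ m : ℕ,
    (∀ l < m, ∀ gs' : List (Gate k σ), gs <+: gs' →
      (∀ g ∈ gs', g.fanIn ≤ 2 ∧ g.HasSignConstants) → (∀ l' < l, Q l' gs') →
      ∃ gs'' : List (Gate k σ), gs' <+: gs'' ∧ (∀ g ∈ gs'', g.fanIn ≤ 2 ∧ g.HasSignConstants) ∧
        gs''.length ≤ gs'.length + cost ∧ Q l gs'') →
    ∃ gs' : List (Gate k σ), gs <+: gs' ∧ (∀ g ∈ gs', g.fanIn ≤ 2 ∧ g.HasSignConstants) ∧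
      gs'.length ≤ gs.length + cost * m ∧ ∀ l < m, Q l gs' := by
  intro m
  induction m with
  | zero =>
    intro _
    exact ⟨gs, List.prefix_rfl, hgs, by simp, fun l hl => absurd hl (Nat.not_lt_zero l)⟩
  | succ m ih =>
    intro h
    obtain ⟨gs₁, hpre₁, hgood₁, hlen₁, hQ₁⟩ :=
      ih fun l hl gs' hp hg hQ' => h l (Nat.lt_succ_of_lt hl) gs' hp hg hQ'
    obtain ⟨gs₂, hpre₂, hgood₂, hlen₂, hQ₂⟩ := h m (Nat.lt_succ_self m) gs₁ hpre₁ hgood₁ hQ₁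
    refine ⟨gs₂, hpre₁.trans hpre₂, hgood₂, ?_, fun l hl => ?_⟩
    · rw [Nat.mul_succ]; omega
    · rcases Nat.lt_succ_iff_lt_or_eq.mp hl with hl | rfl
      · exact hQ l gs₁ gs₂ hpre₂ (hQ₁ l hl)
      · exact hQ₂

/-- Accumulating a sum `∑_{l < m} t l` of terms each available after at most `cost` more gates:
`(cost + 1) * m` gates (partial sums are added with the coefficient-`1` sum gate).
[cite: Burgisser2000, Def. 2.1] -/
theorem avail_sum_range (t : ℕ → MvPolynomial σ k) (cost : ℕ)
    (gs : List (Gate k σ)) (hgs : ∀ g ∈ gs, g.fanIn ≤ 2 ∧ g.HasSignConstants) :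
    ∀ m : ℕ,
    (∀ l < m, ∀ gs' : List (Gate k σ), gs <+: gs' →
      (∀ g ∈ gs', g.fanIn ≤ 2 ∧ g.HasSignConstants) →
      ∃ gs'' : List (Gate k σ), gs' <+: gs'' ∧ (∀ g ∈ gs'', g.fanIn ≤ 2 ∧ g.HasSignConstants) ∧
        gs''.length ≤ gs'.length + cost ∧
        ∃ u : Operand k σ, u.RefsBelow gs''.length ∧ u.HasSignConstants ∧
          u.eval (gateValues gs'') = t l) →
    ∃ gs' : List (Gate k σ), gs <+: gs' ∧ (∀ g ∈ gs', g.fanIn ≤ 2 ∧ g.HasSignConstants) ∧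
      gs'.length ≤ gs.length + (cost + 1) * m ∧
      ∃ u : Operand k σ, u.RefsBelow gs'.length ∧ u.HasSignConstants ∧
        u.eval (gateValues gs') = ∑ l ∈ Finset.range m, t l := by
  intro m
  induction m with
  | zero =>
    intro _
    refine ⟨gs, List.prefix_rfl, hgs, by simp, ?_⟩
    simpa using avail_C gs (isSignConstant_zero (k := k))
  | succ m ih =>
    intro h
    obtain ⟨gs₁, hpre₁, hgood₁, hlen₁, hS⟩ :=
      ih fun l hl gs' hp hg => h l (Nat.lt_succ_of_lt hl) gs' hp hg
    obtain ⟨gs₂, hpre₂, hgood₂, hlen₂, ht⟩ := h m (Nat.lt_succ_self m) gs₁ hpre₁ hgood₁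
    obtain ⟨gs₃, hpre₃, hgood₃, hlen₃, hu⟩ := extend_wsum hgood₂ (isSignConstant_one (k := k))
      (isSignConstant_one (k := k)) (avail_mono hpre₂ hS) ht
    refine ⟨gs₃, hpre₁.trans (hpre₂.trans hpre₃), hgood₃, ?_, ?_⟩
    · rw [Nat.mul_succ]; omega
    · simpa [Finset.sum_range_succ] using hu

end CFGates

end ArithCircuit

end Literature.Computability.AlgebraicComplexity

end
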